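import Mathlib.Probability.Process.Kolmogorov
import Mathlib.Topology.ExtendFrom
import Mathlib.MeasureTheory.Function.ConvergenceInMeasure
import Mathlib.Analysis.SpecificLimits.Basic
import HarnessLib

/-!
# The Kolmogorov–Chentsov continuity theorem on `ℝ≥0` (dyadic proof)

We prove the classical Kolmogorov–Chentsov continuity criterion ("Kolmogorov's lemma") for a
stochastic process `X : ℝ≥0 → Ω → E` with values in a *complete* (extended) metric space `E`
carrying its Borel σ-algebra: if `X` satisfies Mathlib's Kolmogorov condition
`ProbabilityTheory.IsKolmogorovProcess X P p q M`, i.e. the pairs `(X s, X t)` are measurable and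
`∫⁻ ω, edist (X s ω) (X t ω) ^ p ∂P ≤ M * edist s t ^ q`, and `q > 1`, then `X` admits a
modification `Y` (`Y t =ᵐ[P] X t` for every `t`) all of whose marginals `Y t` are measurable and
*all* of whose paths `t ↦ Y t ω` are continuous
(`Literature.Probability.Process.exists_modification_continuous_of_isKolmogorovProcess`). No finiteness assumption on `P`
is needed.

Mathlib (pinned commit) has the predicate `IsKolmogorovProcess` but not the theorem; the
Lean formalisation of Degenne–Ledvinka–Marion–Pfaffelhuber (arXiv:2511.20118, Thm 4.20/4.21)
proves a far more general chaining version which is not (yet) in Mathlib.  Here we follow the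
textbook dyadic proof (Le Gall, *Brownian Motion, Martingales, and Stochastic Calculus* (2016),
Thm 2.9 with Lemma 2.10; Kallenberg, *Foundations of Modern Probability* (2002), Thm 3.23;
arXiv:2511.20118 §2.3):

1. (`Literature.Probability.Process.KolmogorovChentsov.chain`) deterministic dyadic chaining: increments over consecutive
   level-`m` dyadics bounded by `δ m` for `m > n` force `edist (f s) (f t) ≤ 2 ∑_{n<j≤m} δ j` for
   level-`m` dyadics `s ≤ t ≤ N` with `t - s < 2⁻ⁿ`;
2. Markov's inequality and the Borel–Cantelli lemma give, for every `N : ℕ`, almost surely a rank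
   after which all consecutive level-`m` increments on `[0, N]` are `≤ 2^(-γ m)`, `γ = (q-1)/(2p)`;
3. hence almost every path is uniformly continuous on the dyadics of `[0, N]` for every `N`, so by
   completeness it extends (Mathlib's `extendFrom`) to a continuous path; measurability of the
   extension is by pointwise limits, and `Y t = X t` a.e. because `X s → X t` in measure as `s → t`.

All declarations live in `namespace Literature` / `Literature.KolmogorovChentsov`.

## References

* J.-F. Le Gall, *Brownian Motion, Martingales, and Stochastic Calculus*, GTM 274, Springer 2016,
  Thm 2.9 (Kolmogorov's lemma), Lemma 2.10, Cor 2.11.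
* O. Kallenberg, *Foundations of Modern Probability* (2nd ed., 2002), Thm 3.23.
* R. Degenne, D. Ledvinka, E. Marion, P. Pfaffelhuber, *Formalization of Brownian motion in Lean*,
  arXiv:2511.20118, §2.3 and Thm 4.20–4.21.
-/

open MeasureTheory ProbabilityTheory Filter Set
open scoped ENNReal NNReal Topology

namespace Literature.Probability.Process

namespace KolmogorovChentsov

/-! ### Dyadic points of `ℝ≥0` -/

/-- The dyadic point `k / 2 ^ m` of level `m` in `ℝ≥0`. [folklore] -/
noncomputable def dyad (m k : ℕ) : ℝ≥0 := (k : ℝ≥0) / 2 ^ m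

/-- The set of all dyadic points `k / 2 ^ m` of `ℝ≥0`. [folklore] -/
def dyadics : Set ℝ≥0 := {x | ∃ m k : ℕ, x = dyad m k}

/-- The real value of the dyadic point `dyad m k` is `k / 2 ^ m`. [folklore] -/
@[simp] theorem coe_dyad (m k : ℕ) : ((dyad m k : ℝ≥0) : ℝ) = k / 2 ^ m := by
  simp [dyad]

/-- `dyad m k` is a dyadic point. [folklore] -/
theorem dyad_mem_dyadics (m k : ℕ) : dyad m k ∈ dyadics := ⟨m, k, rfl⟩

/-- Passing to the next level doubles the numerator. [folklore] -/
theorem dyad_succ_two_mul (m k : ℕ) : dyad (m + 1) (2 * k) = dyad m k := by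
  apply NNReal.coe_injective
  simp only [coe_dyad, Nat.cast_mul, Nat.cast_ofNat, pow_succ]
  field_simp

/-- Raising the level by `j` multiplies the numerator by `2 ^ j`. [folklore] -/
theorem dyad_add_mul (m j k : ℕ) : dyad (m + j) (2 ^ j * k) = dyad m k := by
  apply NNReal.coe_injective
  simp only [coe_dyad, Nat.cast_mul, Nat.cast_pow, Nat.cast_ofNat, pow_add]
  field_simp

/-- `k / 2 ^ m ≤ N` iff `k ≤ N 2 ^ m`. [folklore] -/
theorem dyad_le_natCast_iff {m k N : ℕ} : dyad m k ≤ (N : ℝ≥0) ↔ k ≤ N * 2 ^ m := by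
  rw [← NNReal.coe_le_coe, coe_dyad, NNReal.coe_natCast, div_le_iff₀ (by positivity)]
  norm_cast

/-- Distance between two dyadic points of the same level. [folklore] -/
theorem dist_dyad (m a b : ℕ) : dist (dyad m a) (dyad m b) = |(a : ℝ) - b| / 2 ^ m := by
  rw [NNReal.dist_eq, coe_dyad, coe_dyad, ← sub_div, abs_div, abs_pow, abs_two]

/-- Consecutive level-`m` dyadic points are at distance `2⁻ᵐ`. [folklore] -/
theorem dist_dyad_succ (m k : ℕ) : dist (dyad m k) (dyad m (k + 1)) = (2 ^ m)⁻¹ := by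
  rw [dist_dyad]
  simp

/-- Consecutive level-`m` dyadic points are at extended distance `2⁻ᵐ`. [folklore] -/
theorem edist_dyad_succ (m k : ℕ) : edist (dyad m k) (dyad m (k + 1)) = (2 : ℝ≥0∞)⁻¹ ^ m := by
  rw [edist_dist, dist_dyad_succ, ← inv_pow, ENNReal.ofReal_pow (by positivity),
    ENNReal.ofReal_inv_of_pos (by positivity), ENNReal.ofReal_ofNat]

/-- Every point `t` of `ℝ≥0` is within `2⁻ᵐ` of the level-`m` dyadic `⌊t 2^m⌋ / 2^m`. [folklore] -/
theorem dist_dyad_floor_le (t : ℝ≥0) (m : ℕ) :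
    dist (dyad m ⌊(t : ℝ) * 2 ^ m⌋₊) t ≤ (2 ^ m)⁻¹ := by
  have h0 : (0 : ℝ) ≤ (t : ℝ) * 2 ^ m := by positivity
  have h1 := Nat.floor_le h0
  have h2 := (Nat.lt_floor_add_one ((t : ℝ) * 2 ^ m)).le
  have hp : (0 : ℝ) < 2 ^ m := by positivity
  rw [NNReal.dist_eq, coe_dyad, abs_sub_comm, abs_of_nonneg, sub_le_iff_le_add,
    ← sub_le_iff_le_add', le_div_iff₀ hp, sub_mul, inv_mul_cancel₀ hp.ne']
  · linarith
  · rw [sub_nonneg, div_le_iff₀ hp]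
    exact h1

/-- The dyadic points are dense in `ℝ≥0`. [folklore] -/
theorem dense_dyadics : Dense dyadics := by
  intro t
  rw [Metric.mem_closure_iff]
  intro ε hε
  obtain ⟨m, hm⟩ := exists_pow_lt_of_lt_one hε (by norm_num : (2⁻¹ : ℝ) < 1)
  refine ⟨dyad m ⌊(t : ℝ) * 2 ^ m⌋₊, dyad_mem_dyadics _ _, ?_⟩
  rw [dist_comm]
  exact (dist_dyad_floor_le t m).trans_lt (by simpa [inv_pow] using hm)

/-- The sequence of level-`m` dyadic approximations from below converges to `t` within the
dyadics. [folklore] -/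
theorem tendsto_dyad_floor (t : ℝ≥0) :
    Tendsto (fun m : ℕ ↦ dyad m ⌊(t : ℝ) * 2 ^ m⌋₊) atTop (𝓝[dyadics] t) := by
  rw [tendsto_nhdsWithin_iff]
  refine ⟨?_, Eventually.of_forall fun m ↦ dyad_mem_dyadics _ _⟩
  rw [Metric.tendsto_atTop]
  intro ε hε
  obtain ⟨m₀, hm₀⟩ := exists_pow_lt_of_lt_one hε (by norm_num : (2⁻¹ : ℝ) < 1)
  refine ⟨m₀, fun m hm ↦ (dist_dyad_floor_le t m).trans_lt ?_⟩
  rw [← inv_pow]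
  exact (pow_le_pow_of_le_one (by norm_num) (by norm_num) hm).trans_lt hm₀

/-! ### Dyadic chaining (Le Gall, Lemma 2.10) -/

variable {E : Type*} [PseudoEMetricSpace E]

/-- **Dyadic chaining** (Le Gall 2016, Lemma 2.10, in the inductive form of Karatzas–Shreve):
if the increments of `f` over consecutive level-`m` dyadics of `[0, N]` are bounded by `δ m` for
all `m > n`, then for level-`m` dyadics `a/2^m ≤ b/2^m ≤ N` with `b - a < 2^(m-n)` one has
`edist (f (a/2^m)) (f (b/2^m)) ≤ 2 ∑_{i < m - n} δ (n + 1 + i)`.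
[cite: Legall2016, Lemma 2.10] -/
theorem chain {f : ℝ≥0 → E} {δ : ℕ → ℝ≥0∞} {N n : ℕ}
    (h : ∀ m, n < m → ∀ k, k + 1 ≤ N * 2 ^ m → edist (f (dyad m k)) (f (dyad m (k + 1))) ≤ δ m) :
    ∀ m, n ≤ m → ∀ a b, a ≤ b → b ≤ N * 2 ^ m → b - a < 2 ^ (m - n) →
      edist (f (dyad m a)) (f (dyad m b)) ≤ 2 * ∑ i ∈ Finset.range (m - n), δ (n + 1 + i) := by
  intro m hm
  induction m, hm using Nat.le_induction with
  | base =>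
    intro a b hab hb hba
    obtain rfl : a = b := by simp at hba; omega
    simp
  | succ m hm ih =>
    intro a b hab hb hba
    rcases hab.eq_or_lt with rfl | hab'
    · simp
    -- parents at level `m`
    set a' := (a + 1) / 2 with ha'
    set b' := b / 2 with hb'
    have hpow : 2 ^ (m + 1 - n) = 2 * 2 ^ (m - n) := by
      rw [Nat.sub_add_comm hm, pow_succ, mul_comm]
    rw [hpow] at hba
    have h1 : a' ≤ b' := by omega
    have h2 : b' ≤ N * 2 ^ m := by
      have : b ≤ N * 2 ^ m * 2 := by simpa [pow_succ, mul_assoc] using hb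
      omega
    have h3 : b' - a' < 2 ^ (m - n) := by omega
    have hih := ih a' b' h1 h2 h3
    -- left end: from `a` to `2 a'`
    have hl : edist (f (dyad (m + 1) a)) (f (dyad m a')) ≤ δ (m + 1) := by
      rw [← dyad_succ_two_mul m a']
      rcases Nat.even_or_odd a with ⟨j, hj⟩ | ⟨j, hj⟩
      · have : 2 * a' = a := by omega
        rw [this, edist_self]; exact zero_le
      · have : 2 * a' = a + 1 := by omega
        rw [this]
        exact h (m + 1) (by omega) a (by omega)
    -- right end: from `2 b'` to `b`
    have hr : edist (f (dyad m b')) (f (dyad (m + 1) b)) ≤ δ (m + 1) := by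
      rw [← dyad_succ_two_mul m b']
      rcases Nat.even_or_odd b with ⟨j, hj⟩ | ⟨j, hj⟩
      · have : 2 * b' = b := by omega
        rw [this, edist_self]; exact zero_le
      · have h2b : 2 * b' + 1 = b := by omega
        have := h (m + 1) (by omega) (2 * b') (by omega)
        rwa [h2b] at this
    have hrange : m + 1 - n = (m - n) + 1 := by omega
    calc edist (f (dyad (m + 1) a)) (f (dyad (m + 1) b))
        ≤ edist (f (dyad (m + 1) a)) (f (dyad m a')) + edist (f (dyad m a')) (f (dyad m b'))
          + edist (f (dyad m b')) (f (dyad (m + 1) b)) := edist_triangle4 _ _ _ _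
      _ ≤ δ (m + 1) + 2 * ∑ i ∈ Finset.range (m - n), δ (n + 1 + i) + δ (m + 1) := by
          gcongr
      _ = 2 * ∑ i ∈ Finset.range (m + 1 - n), δ (n + 1 + i) := by
          rw [hrange, Finset.sum_range_succ, show n + 1 + (m - n) = m + 1 by omega]
          ring

/-! ### From eventually small increments to uniform continuity on dyadics -/

/-- Tail of a geometric series in `ℝ≥0∞`: `∑_{i<m-n} r^(n+1+i) ≤ r^(n+1) (1-r)⁻¹`. [folklore] -/
theorem sum_range_pow_le (r : ℝ≥0∞) (n m : ℕ) :
    ∑ i ∈ Finset.range (m - n), r ^ (n + 1 + i) ≤ r ^ (n + 1) * (1 - r)⁻¹ := by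
  calc ∑ i ∈ Finset.range (m - n), r ^ (n + 1 + i)
      ≤ ∑' i, r ^ (n + 1 + i) := ENNReal.sum_le_tsum _
    _ = r ^ (n + 1) * ∑' i : ℕ, r ^ i := by
        simp_rw [pow_add]; rw [ENNReal.tsum_mul_left]
    _ = r ^ (n + 1) * (1 - r)⁻¹ := by rw [ENNReal.tsum_geometric]

/-- The geometric tail bound `2 r^(n+1) (1-r)⁻¹` tends to `0` when `r < 1`. [folklore] -/
theorem tendsto_pow_succ_mul_atTop {r : ℝ≥0∞} (hr : r < 1) :
    Tendsto (fun n : ℕ ↦ 2 * (r ^ (n + 1) * (1 - r)⁻¹)) atTop (𝓝 0) := by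
  have h1 : Tendsto (fun n : ℕ ↦ r ^ (n + 1)) atTop (𝓝 0) :=
    (ENNReal.tendsto_pow_atTop_nhds_zero_iff.2 hr).comp (tendsto_add_atTop_nat 1)
  have h2 : (1 - r)⁻¹ ≠ ∞ := ENNReal.inv_ne_top.2 (tsub_pos_of_lt hr).ne'
  have h3 := ENNReal.Tendsto.mul_const h1 (Or.inr h2)
  rw [zero_mul] at h3
  simpa using ENNReal.Tendsto.const_mul h3 (Or.inr ENNReal.ofNat_ne_top)

/-- A path is *locally uniformly continuous on the dyadics* if for every `N` it is uniformly
continuous on the dyadic points of `[0, N]`. [folklore] -/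
def LocallyUniformOnDyadics (f : ℝ≥0 → E) : Prop :=
  ∀ N : ℕ, ∀ ε : ℝ≥0∞, 0 < ε → ∃ ρ : ℝ, 0 < ρ ∧ ∀ s ∈ dyadics, ∀ t ∈ dyadics,
    s ≤ N → t ≤ N → dist s t < ρ → edist (f s) (f t) ≤ ε

/-- If, on `[0, N]`, the increments of a path over consecutive level-`m` dyadics are eventually
(in `m`) bounded by `r ^ m` with `r < 1`, then the path is uniformly continuous on the dyadics of
`[0, N]` (Le Gall 2016, proof of Thm 2.9). [cite: Legall2016, Thm 2.9] -/
theorem uniformOn_of_increments_le {f : ℝ≥0 → E} {r : ℝ≥0∞} (hr : r < 1) {N n₀ : ℕ}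
    (h : ∀ m, n₀ < m → ∀ k, k + 1 ≤ N * 2 ^ m →
      edist (f (dyad m k)) (f (dyad m (k + 1))) ≤ r ^ m)
    {ε : ℝ≥0∞} (hε : 0 < ε) :
    ∃ ρ : ℝ, 0 < ρ ∧ ∀ s ∈ dyadics, ∀ t ∈ dyadics,
      s ≤ N → t ≤ N → dist s t < ρ → edist (f s) (f t) ≤ ε := by
  -- choose the scale `n ≥ n₀` with tail bound `≤ ε`
  obtain ⟨n, hn₀, hn⟩ : ∃ n, n₀ ≤ n ∧ 2 * (r ^ (n + 1) * (1 - r)⁻¹) ≤ ε := by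
    have hev := (tendsto_pow_succ_mul_atTop hr).eventually (ge_mem_nhds hε)
    obtain ⟨n, hn⟩ := (hev.and (eventually_ge_atTop n₀)).exists
    exact ⟨n, hn.2, hn.1⟩
  refine ⟨(2 ^ n)⁻¹, by positivity, ?_⟩
  -- reduce to a common level `m ≥ n` and `a ≤ b`
  suffices key : ∀ m, n ≤ m → ∀ a b, a ≤ b → dyad m b ≤ N → dist (dyad m a) (dyad m b) < (2 ^ n)⁻¹ →
      edist (f (dyad m a)) (f (dyad m b)) ≤ ε by
    rintro s ⟨m₁, a₁, rfl⟩ t ⟨m₂, b₁, rfl⟩ hs ht hst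
    set m := max n (max m₁ m₂) with hm
    have hm₁ : m₁ ≤ m := le_max_of_le_right (le_max_left _ _)
    have hm₂ : m₂ ≤ m := le_max_of_le_right (le_max_right _ _)
    obtain ⟨a, ha⟩ : ∃ a, dyad m₁ a₁ = dyad m a :=
      ⟨2 ^ (m - m₁) * a₁, by rw [← dyad_add_mul m₁ (m - m₁) a₁, Nat.add_sub_cancel' hm₁]⟩
    obtain ⟨b, hb⟩ : ∃ b, dyad m₂ b₁ = dyad m b :=
      ⟨2 ^ (m - m₂) * b₁, by rw [← dyad_add_mul m₂ (m - m₂) b₁, Nat.add_sub_cancel' hm₂]⟩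
    rw [ha] at hs hst ⊢
    rw [hb] at ht hst ⊢
    rcases le_total a b with hab | hab
    · exact key m (le_max_left _ _) a b hab ht hst
    · rw [edist_comm]
      rw [dist_comm] at hst
      exact key m (le_max_left _ _) b a hab hs hst
  intro m hm a b hab hb hd
  rw [dyad_le_natCast_iff] at hb
  have hba : b - a < 2 ^ (m - n) := by
    rw [dist_dyad, abs_sub_comm, abs_of_nonneg (by simpa using hab), div_lt_iff₀ (by positivity),
      ← one_div, div_mul_eq_mul_div, one_mul, lt_div_iff₀ (by positivity)] at hd
    have : ((b - a : ℕ) : ℝ) < 2 ^ (m - n) := by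
      rw [Nat.cast_sub hab, lt_iff_not_ge]
      intro hle
      have := (mul_le_mul_of_nonneg_right hle (by positivity : (0 : ℝ) ≤ 2 ^ n)).trans_lt hd
      rw [← pow_add, Nat.sub_add_cancel hm] at this
      exact lt_irrefl _ this
    exact_mod_cast this
  have hchain := chain (f := f) (δ := fun m ↦ r ^ m) (N := N) (n := n)
    (fun m hm k hk ↦ h m (lt_of_le_of_lt hn₀ hm) k hk) m hm a b hab hb hba
  refine hchain.trans (le_trans ?_ hn)
  gcongr
  exact sum_range_pow_le r n m

/-! ### Extension of locally uniformly continuous paths from the dyadics -/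

/-- A path locally uniformly continuous on the dyadics is continuous within the dyadics at every
dyadic point. [folklore] -/
theorem LocallyUniformOnDyadics.tendsto_self {f : ℝ≥0 → E} (hf : LocallyUniformOnDyadics f)
    {t : ℝ≥0} (ht : t ∈ dyadics) : Tendsto f (𝓝[dyadics] t) (𝓝 (f t)) := by
  rw [EMetric.tendsto_nhds]
  intro ε hε
  obtain ⟨ε', hε'0, hε'⟩ := exists_between hε
  set N : ℕ := ⌈t⌉₊ + 1 with hN
  have htN : t < N := by
    rw [hN]; push_cast; exact (Nat.le_ceil t).trans_lt (lt_add_one _)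
  obtain ⟨ρ, hρ, H⟩ := hf N ε' hε'0
  have hV : Metric.ball t ρ ∩ Iio (N : ℝ≥0) ∈ 𝓝 t :=
    inter_mem (Metric.ball_mem_nhds t hρ) (isOpen_Iio.mem_nhds htN)
  filter_upwards [inter_mem_nhdsWithin dyadics hV] with s hs
  obtain ⟨hsD, hsball, hsN⟩ := hs
  exact (H s hsD t ht (le_of_lt hsN) htN.le (by simpa [dist_comm] using hsball)).trans_lt hε'

/-- A path locally uniformly continuous on the dyadics, with values in a complete space, has a
limit within the dyadics at every point of `ℝ≥0` (Cauchy filter argument; Le Gall 2016, proof of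
Thm 2.9). [cite: Legall2016, Thm 2.9] -/
theorem LocallyUniformOnDyadics.exists_tendsto [CompleteSpace E] {f : ℝ≥0 → E}
    (hf : LocallyUniformOnDyadics f) (t : ℝ≥0) : ∃ y, Tendsto f (𝓝[dyadics] t) (𝓝 y) := by
  have hne : (𝓝[dyadics] t).NeBot := mem_closure_iff_nhdsWithin_neBot.1 (dense_dyadics t)
  suffices hc : Cauchy (map f (𝓝[dyadics] t)) by
    obtain ⟨y, hy⟩ := CompleteSpace.complete hc
    exact ⟨y, hy⟩
  rw [EMetric.cauchy_iff]
  refine ⟨(hne.map f).ne, fun ε hε ↦ ?_⟩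
  obtain ⟨ε', hε'0, hε'⟩ := exists_between hε
  set N : ℕ := ⌈t⌉₊ + 1 with hN
  have htN : t < N := by
    rw [hN]; push_cast; exact (Nat.le_ceil t).trans_lt (lt_add_one _)
  obtain ⟨ρ, hρ, H⟩ := hf N ε' hε'0
  have hV : Metric.ball t (ρ / 2) ∩ Iio (N : ℝ≥0) ∈ 𝓝 t :=
    inter_mem (Metric.ball_mem_nhds t (half_pos hρ)) (isOpen_Iio.mem_nhds htN)
  refine ⟨f '' (dyadics ∩ (Metric.ball t (ρ / 2) ∩ Iio (N : ℝ≥0))),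
    image_mem_map (inter_mem_nhdsWithin dyadics hV), ?_⟩
  rintro _ ⟨s, ⟨hsD, hsball, hsN⟩, rfl⟩ _ ⟨s', ⟨hs'D, hs'ball, hs'N⟩, rfl⟩
  refine (H s hsD s' hs'D (le_of_lt hsN) (le_of_lt hs'N) ?_).trans_lt hε'
  calc dist s s' ≤ dist s t + dist t s' := dist_triangle _ _ _
    _ < ρ / 2 + ρ / 2 := add_lt_add (by simpa using hsball) (by simpa [dist_comm] using hs'ball)
    _ = ρ := add_halves ρ

/-- The extension from the dyadics of a locally uniformly continuous path is continuous
(values in a complete space). [folklore] -/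
theorem LocallyUniformOnDyadics.continuous_extendFrom [CompleteSpace E] {f : ℝ≥0 → E}
    (hf : LocallyUniformOnDyadics f) : Continuous (extendFrom dyadics f) :=
  _root_.continuous_extendFrom dense_dyadics hf.exists_tendsto

/-! ### The probabilistic estimates: Markov and Borel–Cantelli -/

section Estimates

variable {Ω : Type*} {mΩ : MeasurableSpace Ω} {P : Measure Ω} {p q : ℝ} {M : ℝ≥0}
  {X : ℝ≥0 → Ω → E}

/-- Markov's inequality under the Kolmogorov condition:
`δ ^ p * P {δ ≤ edist (X s) (X t)} ≤ M * edist s t ^ q`. [folklore] -/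
theorem rpow_mul_measure_le (hX : IsKolmogorovProcess X P p q M) (s t : ℝ≥0) (δ : ℝ≥0∞) :
    δ ^ p * P {ω | δ ≤ edist (X s ω) (X t ω)} ≤ M * edist s t ^ q := by
  have hsub : {ω | δ ≤ edist (X s ω) (X t ω)} ⊆ {ω | δ ^ p ≤ edist (X s ω) (X t ω) ^ p} :=
    fun ω hω ↦ ENNReal.rpow_le_rpow hω hX.p_pos.le
  calc δ ^ p * P {ω | δ ≤ edist (X s ω) (X t ω)}
      ≤ δ ^ p * P {ω | δ ^ p ≤ edist (X s ω) (X t ω) ^ p} :=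
        mul_le_mul_right (measure_mono hsub) _
    _ ≤ ∫⁻ ω, edist (X s ω) (X t ω) ^ p ∂P :=
        mul_meas_ge_le_lintegral₀ (hX.measurable_edist.pow_const p).aemeasurable _
    _ ≤ M * edist s t ^ q := hX.kolmogorovCondition s t

/-- The geometric rate `2 ^ (-(q - 1) / (2 p))` used as increment threshold. [folklore] -/
noncomputable def rate (p q : ℝ) : ℝ≥0∞ := (2 : ℝ≥0∞) ^ (-((q - 1) / (2 * p)))

/-- The rate is `< 1` when `p > 0` and `q > 1`. [folklore] -/
theorem rate_lt_one (hp : 0 < p) (hq : 1 < q) : rate p q < 1 :=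
  ENNReal.rpow_lt_one_of_one_lt_of_neg ENNReal.one_lt_two
    (neg_neg_of_pos (div_pos (by linarith) (by positivity)))

/-- The rate is nonzero. [folklore] -/
theorem rate_ne_zero : rate p q ≠ 0 := by
  simp [rate, ENNReal.rpow_eq_zero_iff]

/-- The rate is finite. [folklore] -/
theorem rate_ne_top : rate p q ≠ ∞ := by
  simp [rate, ENNReal.rpow_eq_top_iff]

/-- The exponent bookkeeping of the Borel–Cantelli step:
`2^m · (M (2⁻ᵐ)^q / ((rate p q)^m)^p) = M · (2^(-(q-1)/2))^m`. [folklore] -/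
theorem card_mul_bound_eq (hp : 0 < p) (m : ℕ) :
    (2 : ℝ≥0∞) ^ m * ((M : ℝ≥0∞) * ((2 : ℝ≥0∞)⁻¹ ^ m) ^ q / ((rate p q) ^ m) ^ p)
      = M * ((2 : ℝ≥0∞) ^ (-((q - 1) / 2))) ^ m := by
  have e1 : ((2 : ℝ≥0∞)⁻¹ ^ m) ^ q = 2 ^ (-(m * q)) := by
    rw [← ENNReal.rpow_natCast, ← ENNReal.rpow_mul, ENNReal.inv_rpow, ← ENNReal.rpow_neg]
  have e2 : ((rate p q) ^ m) ^ p = 2 ^ (-((q - 1) / 2 * m)) := by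
    rw [rate, ← ENNReal.rpow_natCast, ← ENNReal.rpow_mul, ← ENNReal.rpow_mul]
    congr 1
    field_simp
  have e3 : ((2 : ℝ≥0∞) ^ (-((q - 1) / 2))) ^ m = 2 ^ (-((q - 1) / 2 * m)) := by
    rw [← ENNReal.rpow_natCast, ← ENNReal.rpow_mul, neg_mul]
  have e4 : (2 : ℝ≥0∞) ^ m = 2 ^ (m : ℝ) := (ENNReal.rpow_natCast _ _).symm
  rw [e1, e2, e3, e4, ENNReal.div_eq_inv_mul, ← ENNReal.rpow_neg, neg_neg]
  calc (2 : ℝ≥0∞) ^ (m : ℝ) * (2 ^ ((q - 1) / 2 * m) * (M * 2 ^ (-(m * q))))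
      = M * (2 ^ (m : ℝ) * 2 ^ ((q - 1) / 2 * m) * 2 ^ (-(m * q))) := by ring
    _ = M * 2 ^ (-((q - 1) / 2 * m)) := by
        rw [← ENNReal.rpow_add _ _ two_ne_zero ENNReal.ofNat_ne_top,
          ← ENNReal.rpow_add _ _ two_ne_zero ENNReal.ofNat_ne_top]
        congr 2
        ring

/-- **Borel–Cantelli step** (Le Gall 2016, proof of Thm 2.9): under the Kolmogorov condition with
`q > 1`, for every `N`, almost surely, for all sufficiently fine levels `m` every increment of the
path over consecutive level-`m` dyadics of `[0, N]` is at most `rate p q ^ m`.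
[cite: Legall2016, Thm 2.9] -/
theorem ae_eventually_increments_le (hX : IsKolmogorovProcess X P p q M) (hq : 1 < q) (N : ℕ) :
    ∀ᵐ ω ∂P, ∀ᶠ m in atTop, ∀ k, k + 1 ≤ N * 2 ^ m →
      edist (X (dyad m k) ω) (X (dyad m (k + 1)) ω) ≤ (rate p q) ^ m := by
  -- bad events
  set A : ℕ → Set Ω := fun m ↦ ⋃ k ∈ Finset.range (N * 2 ^ m),
    {ω | (rate p q) ^ m < edist (X (dyad m k) ω) (X (dyad m (k + 1)) ω)} with hA
  have hbound : ∀ m, P (A m) ≤ N * (M * ((2 : ℝ≥0∞) ^ (-((q - 1) / 2))) ^ m) := by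
    intro m
    have hk : ∀ k, P {ω | (rate p q) ^ m < edist (X (dyad m k) ω) (X (dyad m (k + 1)) ω)}
        ≤ (M : ℝ≥0∞) * ((2 : ℝ≥0∞)⁻¹ ^ m) ^ q / ((rate p q) ^ m) ^ p := by
      intro k
      have hsub : {ω | (rate p q) ^ m < edist (X (dyad m k) ω) (X (dyad m (k + 1)) ω)}
          ⊆ {ω | (rate p q) ^ m ≤ edist (X (dyad m k) ω) (X (dyad m (k + 1)) ω)} :=
        fun ω hω ↦ Set.mem_setOf.2 (le_of_lt (Set.mem_setOf.1 hω))
      rw [ENNReal.le_div_iff_mul_le (Or.inl _) (Or.inl _), mul_comm]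
      · calc ((rate p q) ^ m) ^ p
              * P {ω | (rate p q) ^ m < edist (X (dyad m k) ω) (X (dyad m (k + 1)) ω)}
            ≤ ((rate p q) ^ m) ^ p
              * P {ω | (rate p q) ^ m ≤ edist (X (dyad m k) ω) (X (dyad m (k + 1)) ω)} :=
              mul_le_mul_right (measure_mono hsub) _
          _ ≤ M * edist (dyad m k) (dyad m (k + 1)) ^ q := rpow_mul_measure_le hX _ _ _
          _ = M * ((2 : ℝ≥0∞)⁻¹ ^ m) ^ q := by rw [edist_dyad_succ]
      · exact (ENNReal.rpow_pos (ENNReal.pow_pos (pos_iff_ne_zero.2 rate_ne_zero) _)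
          (ENNReal.pow_ne_top rate_ne_top)).ne'
      · exact ENNReal.rpow_ne_top_of_nonneg hX.p_pos.le (ENNReal.pow_ne_top rate_ne_top)
    calc P (A m) ≤ ∑ k ∈ Finset.range (N * 2 ^ m),
          P {ω | (rate p q) ^ m < edist (X (dyad m k) ω) (X (dyad m (k + 1)) ω)} :=
          measure_biUnion_finset_le _ _
      _ ≤ ∑ _k ∈ Finset.range (N * 2 ^ m),
          (M : ℝ≥0∞) * ((2 : ℝ≥0∞)⁻¹ ^ m) ^ q / ((rate p q) ^ m) ^ p :=
          Finset.sum_le_sum fun k _ ↦ hk k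
      _ = N * ((2 : ℝ≥0∞) ^ m * ((M : ℝ≥0∞) * ((2 : ℝ≥0∞)⁻¹ ^ m) ^ q / ((rate p q) ^ m) ^ p)) := by
          rw [Finset.sum_const, Finset.card_range, nsmul_eq_mul]
          push_cast
          ring
      _ = N * (M * ((2 : ℝ≥0∞) ^ (-((q - 1) / 2))) ^ m) := by rw [card_mul_bound_eq hX.p_pos]
  have hsum : ∑' m, P (A m) ≠ ∞ := by
    have hρ : (2 : ℝ≥0∞) ^ (-((q - 1) / 2)) < 1 :=
      ENNReal.rpow_lt_one_of_one_lt_of_neg ENNReal.one_lt_two (by linarith)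
    refine ne_top_of_le_ne_top ?_ (ENNReal.tsum_le_tsum hbound)
    rw [ENNReal.tsum_mul_left, ENNReal.tsum_mul_left, ENNReal.tsum_geometric]
    exact ENNReal.mul_ne_top (ENNReal.natCast_ne_top N) (ENNReal.mul_ne_top ENNReal.coe_ne_top
      (ENNReal.inv_ne_top.2 (tsub_pos_of_lt hρ).ne'))
  filter_upwards [ae_eventually_notMem hsum] with ω hω
  filter_upwards [hω] with m hm k hk
  simp only [hA, Set.mem_iUnion, Finset.mem_range, Set.mem_setOf_eq, not_exists, not_lt,
    exists_prop, not_and] at hm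
  exact hm k (by omega)

/-- Convergence in measure of `X s` to `X t` along any sequence `u i → t`, under the Kolmogorov
condition (Le Gall 2016, end of proof of Thm 2.9). [cite: Legall2016, Thm 2.9] -/
theorem tendstoInMeasure_of_tendsto (hX : IsKolmogorovProcess X P p q M) {u : ℕ → ℝ≥0} {t : ℝ≥0}
    (hu : Tendsto u atTop (𝓝 t)) :
    TendstoInMeasure P (fun i ↦ X (u i)) atTop (X t) := by
  refine tendstoInMeasure_of_ne_top fun ε hε hεtop ↦ ?_
  have hεp : ε ^ p ≠ 0 := (ENNReal.rpow_pos hε hεtop).ne'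
  have hbound : ∀ i, P {ω | ε ≤ edist (X (u i) ω) (X t ω)} ≤ M * edist (u i) t ^ q / ε ^ p := by
    intro i
    rw [ENNReal.le_div_iff_mul_le (Or.inl hεp) (Or.inl (ENNReal.rpow_ne_top_of_nonneg
      hX.p_pos.le hεtop)), mul_comm]
    exact rpow_mul_measure_le hX _ _ _
  have hlim : Tendsto (fun i ↦ (M : ℝ≥0∞) * edist (u i) t ^ q / ε ^ p) atTop (𝓝 0) := by
    have h1 : Tendsto (fun i ↦ edist (u i) t) atTop (𝓝 0) := (tendsto_iff_edist_tendsto_0.1 hu)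
    have h2 : Tendsto (fun i ↦ edist (u i) t ^ q) atTop (𝓝 0) := by
      have := ((ENNReal.continuous_rpow_const (y := q)).tendsto 0).comp h1
      rwa [ENNReal.zero_rpow_of_pos hX.q_pos] at this
    have h3 := ENNReal.Tendsto.const_mul h2 (Or.inr (ENNReal.coe_ne_top (r := M)))
    rw [mul_zero] at h3
    have h4 := ENNReal.Tendsto.div_const h3 (Or.inr hεp) (b := ε ^ p)
    rwa [ENNReal.zero_div] at h4
  exact tendsto_of_tendsto_of_tendsto_of_le_of_le tendsto_const_nhds hlim (fun _ ↦ zero_le) hbound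

end Estimates

/-! ### The continuous modification -/

section Modification

variable {Ω : Type*} {mΩ : MeasurableSpace Ω} {P : Measure Ω} {p q : ℝ} {M : ℝ≥0}
  {X : ℝ≥0 → Ω → E}

/-- The set of *good* sample points: those `ω` for which, on every `[0, N]`, the increments of the
path over consecutive level-`m` dyadics are eventually bounded by `rate p q ^ m`. [folklore] -/
def goodSet (X : ℝ≥0 → Ω → E) (p q : ℝ) : Set Ω :=
  {ω | ∀ N : ℕ, ∃ n₀ : ℕ, ∀ m, n₀ < m → ∀ k, k + 1 ≤ N * 2 ^ m →
    edist (X (dyad m k) ω) (X (dyad m (k + 1)) ω) ≤ (rate p q) ^ m}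

/-- The good set is measurable (the increments `edist (X s) (X t)` are measurable under the
Kolmogorov condition). [folklore] -/
theorem measurableSet_goodSet (hX : IsKolmogorovProcess X P p q M) :
    MeasurableSet (goodSet X p q) := by
  have : goodSet X p q = ⋂ N : ℕ, ⋃ n₀ : ℕ, ⋂ m : ℕ, ⋂ (_ : n₀ < m), ⋂ k : ℕ,
      ⋂ (_ : k + 1 ≤ N * 2 ^ m),
        {ω | edist (X (dyad m k) ω) (X (dyad m (k + 1)) ω) ≤ (rate p q) ^ m} := by
    ext ω
    simp only [goodSet, mem_setOf_eq, mem_iInter, mem_iUnion]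
  rw [this]
  exact MeasurableSet.iInter fun N ↦ MeasurableSet.iUnion fun n₀ ↦ MeasurableSet.iInter fun m ↦
    MeasurableSet.iInter fun _ ↦ MeasurableSet.iInter fun k ↦ MeasurableSet.iInter fun _ ↦
      measurableSet_le hX.measurable_edist measurable_const

/-- Almost every sample point is good (Borel–Cantelli step for every `N`).
[cite: Legall2016, Thm 2.9] -/
theorem ae_mem_goodSet (hX : IsKolmogorovProcess X P p q M) (hq : 1 < q) :
    ∀ᵐ ω ∂P, ω ∈ goodSet X p q := by
  have := ae_all_iff.2 fun N ↦ ae_eventually_increments_le hX hq N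
  filter_upwards [this] with ω hω N
  obtain ⟨n₀, hn₀⟩ := eventually_atTop.1 (hω N)
  exact ⟨n₀, fun m hm ↦ hn₀ m hm.le⟩

/-- The path of a good sample point is locally uniformly continuous on the dyadics (chaining).
[cite: Legall2016, Thm 2.9] -/
theorem locallyUniformOnDyadics_of_mem_goodSet (hp : 0 < p) (hq : 1 < q) {ω : Ω}
    (hω : ω ∈ goodSet X p q) : LocallyUniformOnDyadics (X · ω) := by
  intro N ε hε
  obtain ⟨n₀, hn₀⟩ := hω N
  exact uniformOn_of_increments_le (rate_lt_one hp hq) hn₀ hε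

open Classical in
/-- The continuous modification: on the good set, the extension from the dyadics of the path;
elsewhere the constant path `X 0 ω`. [cite: Legall2016, Thm 2.9] -/
noncomputable def modification (X : ℝ≥0 → Ω → E) (p q : ℝ) : ℝ≥0 → Ω → E :=
  fun t ω ↦ if ω ∈ goodSet X p q then extendFrom dyadics (X · ω) t else X 0 ω

/-- On the good set the modification is the extension from the dyadics of the path. [folklore] -/
theorem modification_apply_of_mem {t : ℝ≥0} {ω : Ω} (hω : ω ∈ goodSet X p q) :
    modification X p q t ω = extendFrom dyadics (X · ω) t := by
  simp [modification, hω]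

/-- Off the good set the modification is the constant path `X 0 ω` (documented junk value).
[folklore] -/
theorem modification_apply_of_not_mem {t : ℝ≥0} {ω : Ω} (hω : ω ∉ goodSet X p q) :
    modification X p q t ω = X 0 ω := by
  simp [modification, hω]

variable [CompleteSpace E]

/-- Every path of the modification is continuous. [cite: Legall2016, Thm 2.9] -/
theorem continuous_modification (hp : 0 < p) (hq : 1 < q) (ω : Ω) :
    Continuous (fun t ↦ modification X p q t ω) := by
  by_cases hω : ω ∈ goodSet X p q
  · simp only [modification_apply_of_mem hω]
    exact (locallyUniformOnDyadics_of_mem_goodSet hp hq hω).continuous_extendFrom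
  · simp only [modification_apply_of_not_mem hω]
    exact continuous_const

/-- On the good set, the path converges within the dyadics to the modification.
[cite: Legall2016, Thm 2.9] -/
theorem tendsto_modification (hp : 0 < p) (hq : 1 < q) {ω : Ω} (hω : ω ∈ goodSet X p q)
    (t : ℝ≥0) : Tendsto (X · ω) (𝓝[dyadics] t) (𝓝 (modification X p q t ω)) := by
  rw [modification_apply_of_mem hω]
  exact tendsto_extendFrom ((locallyUniformOnDyadics_of_mem_goodSet hp hq hω).exists_tendsto t)

end Modification

section Main

variable {E : Type*} [EMetricSpace E] [CompleteSpace E] {Ω : Type*} {mΩ : MeasurableSpace Ω}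
  {P : Measure Ω} {p q : ℝ} {M : ℝ≥0} {X : ℝ≥0 → Ω → E}

omit [CompleteSpace E] in
/-- On the good set the modification agrees with the process at dyadic times.
[cite: Legall2016, Thm 2.9] -/
theorem modification_apply_of_mem_dyadics (hp : 0 < p) (hq : 1 < q) {ω : Ω}
    (hω : ω ∈ goodSet X p q) {t : ℝ≥0} (ht : t ∈ dyadics) :
    modification X p q t ω = X t ω := by
  rw [modification_apply_of_mem hω]
  exact extendFrom_eq (dense_dyadics t)
    ((locallyUniformOnDyadics_of_mem_goodSet hp hq hω).tendsto_self ht)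

variable [MeasurableSpace E] [BorelSpace E]

/-- Each marginal of the modification is measurable: it is the pointwise limit of the measurable
maps `goodSet.piecewise (X uᵢ) (X 0)` along dyadics `uᵢ → t`. [cite: Legall2016, Thm 2.9] -/
theorem measurable_modification (hX : IsKolmogorovProcess X P p q M) (hq : 1 < q) (t : ℝ≥0) :
    Measurable (modification X p q t) := by
  classical
  set u : ℕ → ℝ≥0 := fun m ↦ dyad m ⌊(t : ℝ) * 2 ^ m⌋₊ with hu
  have hG := measurableSet_goodSet hX
  refine measurable_of_tendsto_metrizable' atTop
    (f := fun i ↦ (goodSet X p q).piecewise (X (u i)) (X 0))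
    (fun i ↦ Measurable.piecewise hG (hX.measurable _) (hX.measurable _)) ?_
  rw [tendsto_pi_nhds]
  intro ω
  by_cases hω : ω ∈ goodSet X p q
  · simp only [Set.piecewise_eq_of_mem _ _ _ hω]
    exact (tendsto_modification hX.p_pos hq hω t).comp (tendsto_dyad_floor t)
  · simp only [Set.piecewise_eq_of_notMem _ _ _ hω, modification_apply_of_not_mem hω]
    exact tendsto_const_nhds

omit [MeasurableSpace E] [BorelSpace E] in
/-- The modification is a modification: `modification X p q t = X t` almost surely, for every `t`.
[cite: Legall2016, Thm 2.9] -/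
theorem modification_ae_eq (hX : IsKolmogorovProcess X P p q M) (hq : 1 < q) (t : ℝ≥0) :
    modification X p q t =ᵐ[P] X t := by
  set u : ℕ → ℝ≥0 := fun m ↦ dyad m ⌊(t : ℝ) * 2 ^ m⌋₊ with hu
  have hut : Tendsto u atTop (𝓝[dyadics] t) := tendsto_dyad_floor t
  obtain ⟨ns, hns, hlim⟩ :=
    (tendstoInMeasure_of_tendsto hX (hut.mono_right nhdsWithin_le_nhds)).exists_seq_tendsto_ae
  filter_upwards [hlim, ae_mem_goodSet hX hq] with ω hω₁ hω₂
  have h₂ : Tendsto (fun i ↦ X (u (ns i)) ω) atTop (𝓝 (modification X p q t ω)) :=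
    (tendsto_modification hX.p_pos hq hω₂ t).comp (hut.comp hns.tendsto_atTop)
  exact tendsto_nhds_unique h₂ hω₁

end Main

end KolmogorovChentsov

open KolmogorovChentsov in
/-- **Kolmogorov–Chentsov continuity theorem on `ℝ≥0`** (Kolmogorov's lemma; Le Gall 2016,
Thm 2.9 with Remark (i); Kallenberg 2002, Thm 3.23; Degenne–Ledvinka–Marion–Pfaffelhuber,
arXiv:2511.20118, §2.3 / Thm 4.21). A process `X : ℝ≥0 → Ω → E` with values in a complete
(extended) metric space with its Borel σ-algebra which satisfies the Kolmogorov condition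
`IsKolmogorovProcess X P p q M` with `q > 1` has a modification `Y` with measurable marginals
all of whose paths are continuous. No finiteness assumption on `P`.
[cite: Legall2016, Thm 2.9] -/
theorem exists_modification_continuous_of_isKolmogorovProcess
    {E : Type*} [EMetricSpace E] [CompleteSpace E] [MeasurableSpace E] [BorelSpace E]
    {Ω : Type*} {mΩ : MeasurableSpace Ω} {P : Measure Ω} {p q : ℝ} {M : ℝ≥0} {X : ℝ≥0 → Ω → E}
    (hX : IsKolmogorovProcess X P p q M) (hq : 1 < q) :
    ∃ Y : ℝ≥0 → Ω → E, (∀ t, Y t =ᵐ[P] X t) ∧ (∀ t, Measurable (Y t)) ∧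
      ∀ ω, Continuous (Y · ω) :=
  ⟨modification X p q, modification_ae_eq hX hq, measurable_modification hX hq,
    continuous_modification hX.p_pos hq⟩

end Literature.Probability.Process
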